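import Mathlib
import HarnessLib
import Literature.Probability.LatticeModels.RandomClusterShiftedBoxes

/-!
# Ghost-wired connection events of the random-cluster model: restriction to sub-pieces,
# monotonicity in the domain, convergence along translated boxes

Topic `Literature/Probability/LatticeModels` (infrastructure for the wired infinite-volume limit of
the random-cluster model on `ℤ^d` along boxes, continuing `RandomClusterDomainMarkov` and
`RandomClusterShiftedBoxes`; Grimmett 2006, §4.2–4.3 and Thm. (4.19)). For the wired measure
`φ¹_S = rcMeasure (finsetGraph ℤ^d S) p q (∂S wired)` of a finite piece `S` and finitely many probe sets
`K i ⊆ ℤ^d`, the **ghost-wired connection event** of a finite set `T` of index pairs is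
`{ω | ∀ (i,j) ∈ T, ∃ x ∈ K i ∩ S, y ∈ K j ∩ S, x ↔ y in ⟨ω⟩ ∨ K_{∂S}}`
(connection by open edges of `S` and wired pairs of `∂S`, i.e. possibly THROUGH the boundary). We prove:

* `ghostConn_finsetRestrict` — for nested pieces `Λ ⊆ Δ`, a ghost connection in `Δ` restricts to a
  ghost connection in `Λ` as soon as each probe is inside `Λ` or meets `∂Λ` (the cluster-potential
  argument of `clusterCount_openExtension`, Grimmett 2006, Lemma (4.13));
* `rcMeasure_real_ghostConnEvent_icc_anti` — hence, by the monotonicity of the wired measures in the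
  domain (Grimmett 2006, Thm. (4.19)(a), proof, eq. (4.24); `rcMeasure_real_icc_restrict_le`),
  `φ¹_Δ(ghost event of Δ) ≤ φ¹_Λ(ghost event of Λ)` for nested coordinate boxes;
* `tendsto_rcMeasure_real_ghostConnEvent` — along the translated boxes `Λ_L + v`, for probes each
  finite or co-finite, the ghost probabilities converge as `L → ∞` to a limit that does not depend on
  `v` (eventually antitone; `Λ_{L-‖v‖} ⊆ Λ_L + v ⊆ Λ_{L+‖v‖}`, Grimmett 2006, proof of Thm. (4.19)(b)).

Used by the route `CriticalPhenomena/Ising3DConformalLimit/ArmDressing` (crux `BallConnectivityMoebius`,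
lattice translation invariance of the critical FK-Ising connection laws). Not here: the free
boundary condition; the limit as a measure (only the probabilities of these events).

## References

* G. Grimmett, *The Random-Cluster Model*, Springer 2006, §4.2–4.3, Lemma (4.13), Thm. (4.19) and
  its proof, eq. (4.24). [Grimmett2006]
-/

noncomputable section

namespace Literature.Probability.LatticeModels

open _root_.MeasureTheory Finset SimpleGraph Filter _root_.Topology
open Literature.Probability.Percolation

/-! ### Ghost connections restrict to sub-pieces -/

section General

variable {V : Type*} [DecidableEq V] {G : SimpleGraph V} [DecidableRel G.Adj] [G.LocallyFinite]
  {Λ Δ : Finset V} (h : Λ ⊆ Δ)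

omit [G.LocallyFinite] in
/-- A configuration of `E_Δ` is contained in the open extension of its restriction to `E_Λ`
(every edge of `E_Δ` is either inside `Λ` or an outer edge). [folklore] -/
theorem subset_openExtension_finsetRestrict {ω : BondConfig Δ} (hω : ω ⊆ (finsetGraph G Δ).edgeSet) :
    ω ⊆ openExtension G h (finsetRestrict h ω) := by
  intro e he
  unfold openExtension
  by_cases hout : e ∈ outsideEdges G h
  · exact Set.mem_union_right _ (Finset.mem_coe.2 hout)
  · have hin : e ∈ insideEdges G h := by
      rw [← edgeFinset_sdiff_outsideEdges h, Finset.mem_sdiff]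
      exact ⟨mem_edgeFinset.2 (hω he), hout⟩
    obtain ⟨e', -, rfl⟩ := Finset.mem_map.1 hin
    exact Set.mem_union_left _ ⟨e', he, rfl⟩

/-- The cluster potential of the restricted configuration is constant along the paths of the
wired open graph of `Δ` (Grimmett 2006, Lemma (4.13): the tree's `clusterPotential_eq_of_adj`
along a walk, after enlarging `ω ⊆ E_Δ` to the open extension of its restriction).
[cite: Grimmett2006, Lemma (4.13)] -/
theorem clusterPotential_eq_of_reachable_wired
    (hW' : (∃ v : Δ, v.1 ∉ Λ) → (innerBoundary G Λ).Nonempty)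
    {ω : BondConfig Δ} (hω : ω ⊆ (finsetGraph G Δ).edgeSet)
    (c : (openGraph (finsetRestrict h ω) ⊔ wired (wiredBoundary G Λ)).ConnectedComponent)
    {u v : Δ} (huv : (openGraph ω ⊔ wired (wiredBoundary G Δ)).Reachable u v) :
    clusterPotential (finsetRestrict h ω) c u = clusterPotential (finsetRestrict h ω) c v := by
  have hle : openGraph ω ⊔ wired (wiredBoundary G Δ) ≤
      openGraph (openExtension G h (finsetRestrict h ω)) ⊔ wired (wiredBoundary G Δ) :=
    sup_le_sup_right (fromEdgeSet_mono (subset_openExtension_finsetRestrict h hω)) _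
  obtain ⟨p⟩ := huv.mono hle
  clear huv
  induction p with
  | nil => rfl
  | cons hadj _ ih => exact (clusterPotential_eq_of_adj h _ c hW' hadj).trans ih

omit [DecidableRel G.Adj] in
/-- A probe vertex of `Δ` has a representative in `Λ` with the same potential, provided the
probe set is inside `Λ` or meets `∂Λ`: the vertex itself if it lies in `Λ`, a probe vertex of
`∂Λ` otherwise (all of `Δ ∖ Λ` carries the boundary potential). [folklore] -/
theorem exists_rep_clusterPotential (ξ : BondConfig Λ)
    (c : (openGraph ξ ⊔ wired (wiredBoundary G Λ)).ConnectedComponent) {K : Set V}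
    (hadm : (∀ x ∈ K, x ∈ Λ) ∨ ∃ a : Λ, a.1 ∈ K ∧ a.1 ∈ innerBoundary G Λ)
    (v : Δ) (hv : v.1 ∈ K) :
    ∃ a : Λ, a.1 ∈ K ∧
      clusterPotential ξ c v = (openGraph ξ ⊔ wired (wiredBoundary G Λ)).connectedComponentMk a := by
  by_cases hvΛ : v.1 ∈ Λ
  · refine ⟨⟨v.1, hvΛ⟩, hv, ?_⟩
    simp only [clusterPotential, hvΛ, ↓reduceDIte]
  · rcases hadm with hsub | ⟨a, haK, habd⟩
    · exact absurd (hsub _ hv) hvΛ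
    · have hb : (innerBoundary G Λ).Nonempty := ⟨a.1, habd⟩
      refine ⟨a, haK, ?_⟩
      simp only [clusterPotential, hvΛ, hb, ↓reduceDIte]
      exact connectedComponentMk_eq_of_mem_innerBoundary ξ hb.choose_spec habd

/-- **Ghost connections restrict** (the event inclusion behind Grimmett 2006, Thm. (4.19)(b)/(c)
for connection events, via Lemma (4.13)): let `Λ ⊆ Δ` with `∂Λ ≠ ∅` unless `Δ = Λ`, and let two
probe sets each be contained in `Λ` or meet `∂Λ`. If a configuration `ω ⊆ E_Δ` joins the two
probes in `Δ` by a path of open edges and wired pairs of `∂Δ`, then its restriction to `E_Λ`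
joins them in `Λ` by a path of open edges and wired pairs of `∂Λ`. [cite: Grimmett2006, Lemma (4.13)] -/
theorem ghostConn_finsetRestrict
    (hW' : (∃ v : Δ, v.1 ∉ Λ) → (innerBoundary G Λ).Nonempty)
    {ω : BondConfig Δ} (hω : ω ⊆ (finsetGraph G Δ).edgeSet) {Ki Kj : Set V}
    (hi : (∀ x ∈ Ki, x ∈ Λ) ∨ ∃ a : Λ, a.1 ∈ Ki ∧ a.1 ∈ innerBoundary G Λ)
    (hj : (∀ x ∈ Kj, x ∈ Λ) ∨ ∃ a : Λ, a.1 ∈ Kj ∧ a.1 ∈ innerBoundary G Λ)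
    (hc : ∃ x y : Δ, x.1 ∈ Ki ∧ y.1 ∈ Kj ∧ (openGraph ω ⊔ wired (wiredBoundary G Δ)).Reachable x y) :
    ∃ x y : Λ, x.1 ∈ Ki ∧ y.1 ∈ Kj ∧
      (openGraph (finsetRestrict h ω) ⊔ wired (wiredBoundary G Λ)).Reachable x y := by
  obtain ⟨x, y, hx, hy, hxy⟩ := hc
  have hne : Nonempty Λ := by
    rcases hi with hsub | ⟨a, -, -⟩
    · exact ⟨⟨x.1, hsub _ hx⟩⟩
    · exact ⟨a⟩
  obtain ⟨a₀⟩ := hne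
  set c := (openGraph (finsetRestrict h ω) ⊔ wired (wiredBoundary G Λ)).connectedComponentMk a₀
  obtain ⟨a, ha, hpa⟩ := exists_rep_clusterPotential (Δ := Δ) (finsetRestrict h ω) c hi x hx
  obtain ⟨b, hb, hpb⟩ := exists_rep_clusterPotential (Δ := Δ) (finsetRestrict h ω) c hj y hy
  refine ⟨a, b, ha, hb, ?_⟩
  have key := clusterPotential_eq_of_reachable_wired h hW' hω c hxy
  rw [hpa, hpb, ConnectedComponent.eq] at key
  exact key

/-- The same for the ghost-wired connection EVENT of a finite set `T` of index pairs of a probe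
family `K` each member of which is inside `Λ` or meets `∂Λ`. [cite: Grimmett2006, Lemma (4.13)] -/
theorem finsetRestrict_mem_ghostConnEvent
    (hW' : (∃ v : Δ, v.1 ∉ Λ) → (innerBoundary G Λ).Nonempty) {m : ℕ} {K : Fin m → Set V}
    (hadm : ∀ i, (∀ x ∈ K i, x ∈ Λ) ∨ ∃ a : Λ, a.1 ∈ K i ∧ a.1 ∈ innerBoundary G Λ)
    (T : Finset (Fin m × Fin m)) {ω : BondConfig Δ} (hω : ω ⊆ (finsetGraph G Δ).edgeSet)
    (hmem : ω ∈ {ω : BondConfig Δ | ∀ ij ∈ T, ∃ x y : Δ, x.1 ∈ K ij.1 ∧ y.1 ∈ K ij.2 ∧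
      (openGraph ω ⊔ wired (wiredBoundary G Δ)).Reachable x y}) :
    finsetRestrict h ω ∈ {ξ : BondConfig Λ | ∀ ij ∈ T, ∃ x y : Λ, x.1 ∈ K ij.1 ∧ y.1 ∈ K ij.2 ∧
      (openGraph ξ ⊔ wired (wiredBoundary G Λ)).Reachable x y} :=
  fun ij hij => ghostConn_finsetRestrict h hW' hω (hadm ij.1) (hadm ij.2) (hmem ij hij)

omit [DecidableEq V] [DecidableRel G.Adj] [G.LocallyFinite] in
/-- Ghost-wired connection events are increasing. [folklore] -/
theorem isUpperSet_ghostConnEvent (B : Set Λ) {m : ℕ} (K : Fin m → Set V)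
    (T : Finset (Fin m × Fin m)) :
    IsUpperSet {ξ : BondConfig Λ | ∀ ij ∈ T, ∃ x y : Λ, x.1 ∈ K ij.1 ∧ y.1 ∈ K ij.2 ∧
      (openGraph ξ ⊔ wired B).Reachable x y} := by
  intro ξ ξ' hle hξ ij hij
  obtain ⟨x, y, hx, hy, hxy⟩ := hξ ij hij
  exact ⟨x, y, hx, hy, hxy.mono (sup_le_sup_right (fromEdgeSet_mono hle) _)⟩

end General

/-! ### Nested coordinate boxes of `ℤ^d`: the ghost probabilities are antitone in the box -/

section Lattice

variable {d : ℕ}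

/-- The wired random-cluster measure `φ¹_{S,p,q}` of the finite piece `S` of `ℤ^d`. -/
local notation "μ[" p ", " q "](" S ")" =>
  rcMeasure (finsetGraph (zdGraph _) S) p q (wiredBoundary (zdGraph _) S)

/-- The translated box `Λ_L + v = ∏ᵢ [-L + vᵢ, L + vᵢ]`. -/
local notation "Λ⟦" v ", " L "⟧" =>
  Finset.Icc (fun i => -((L : ℕ) : ℤ) + (v : Site _) i) (fun i => ((L : ℕ) : ℤ) + (v : Site _) i)

/-- **Ghost probabilities decrease with the box** (Grimmett 2006, Thm. (4.19)(a), proof,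
eq. (4.24), combined with the event inclusion of Lemma (4.13)): for nested coordinate boxes
`Λ = ∏[aᵢ,bᵢ] ⊆ Δ = ∏[a'ᵢ,b'ᵢ]` of `ℤ^d` (`d ≥ 1`), `0 ≤ p ≤ 1`, `q ≥ 1`, and probes each inside
`Λ` or meeting `∂Λ`, `φ¹_Δ(ghost event of Δ) ≤ φ¹_Λ(ghost event of Λ)`.
[cite: Grimmett2006, Thm. (4.19)(a), proof, eq. (4.24)] -/
theorem rcMeasure_real_ghostConnEvent_icc_anti (hd : 0 < d) {a b a' b' : Site d} (hab : a ≤ b)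
    (h : Finset.Icc a b ⊆ Finset.Icc a' b') {p q : ℝ} (hp : p ∈ Set.Icc (0 : ℝ) 1) (hq : 1 ≤ q)
    {m : ℕ} (K : Fin m → Set (Site d)) (T : Finset (Fin m × Fin m))
    (hadm : ∀ i, (∀ x ∈ K i, x ∈ Finset.Icc a b) ∨
      ∃ z : ↥(Finset.Icc a b), z.1 ∈ K i ∧ z.1 ∈ innerBoundary (zdGraph d) (Finset.Icc a b)) :
    (μ[p, q](Finset.Icc a' b')).real {ω | ∀ ij ∈ T, ∃ x y : ↥(Finset.Icc a' b'),
        x.1 ∈ K ij.1 ∧ y.1 ∈ K ij.2 ∧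
        (openGraph ω ⊔ wired (wiredBoundary (zdGraph d) (Finset.Icc a' b'))).Reachable x y} ≤
      (μ[p, q](Finset.Icc a b)).real {ξ | ∀ ij ∈ T, ∃ x y : ↥(Finset.Icc a b),
        x.1 ∈ K ij.1 ∧ y.1 ∈ K ij.2 ∧
        (openGraph ξ ⊔ wired (wiredBoundary (zdGraph d) (Finset.Icc a b))).Reachable x y} := by
  have hq0 : 0 < q := one_pos.trans_le hq
  have hW' : (∃ v : ↥(Finset.Icc a' b'), v.1 ∉ Finset.Icc a b) →
      (innerBoundary (zdGraph d) (Finset.Icc a b)).Nonempty :=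
    fun _ => innerBoundary_Icc_nonempty hd hab
  calc _ ≤ (μ[p, q](Finset.Icc a' b')).real (finsetRestrict h ⁻¹' {ξ | ∀ ij ∈ T,
          ∃ x y : ↥(Finset.Icc a b), x.1 ∈ K ij.1 ∧ y.1 ∈ K ij.2 ∧
          (openGraph ξ ⊔ wired (wiredBoundary (zdGraph d) (Finset.Icc a b))).Reachable x y}) :=
        rcMeasure_real_mono_on_edgeSets _ hp hq0 _
          (fun ω hω hmem => finsetRestrict_mem_ghostConnEvent h hW' hadm T hω hmem)
    _ ≤ _ := rcMeasure_real_icc_restrict_le h hd hab hp hq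
          (isUpperSet_ghostConnEvent _ K T)

/-! ### Translated boxes `Λ_L + v`: radii, inclusions, admissibility of the probes -/

/-- A finite set of lattice points lies in some centred box. [folklore] -/
theorem exists_subset_box_of_set_finite {s : Set (Site d)} (hs : s.Finite) : ∃ r : ℕ, s ⊆ ↑(box d r) := by
  refine ⟨hs.toFinset.sup siteRad, fun x hx => ?_⟩
  rw [Finset.mem_coe, mem_box_iff_siteRad_le]
  exact Finset.le_sup (f := siteRad) (hs.mem_toFinset.2 hx)

/-- A finite family of probes, each finite or co-finite, has a common radius `r`: every probe is
inside `Λ_r` or contains `ℤ^d ∖ Λ_r`. [folklore] -/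
theorem exists_probeRadius {m : ℕ} {K : Fin m → Set (Site d)}
    (hK : ∀ i, (K i).Finite ∨ (K i)ᶜ.Finite) :
    ∃ r : ℕ, ∀ i, K i ⊆ ↑(box d r) ∨ (K i)ᶜ ⊆ ↑(box d r) := by
  have h1 : ∀ i, ∃ r : ℕ, K i ⊆ ↑(box d r) ∨ (K i)ᶜ ⊆ ↑(box d r) := fun i =>
    (hK i).elim (fun h => (exists_subset_box_of_set_finite h).imp fun _ hr => Or.inl hr)
      (fun h => (exists_subset_box_of_set_finite h).imp fun _ hr => Or.inr hr)
  choose r hr using h1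
  refine ⟨Finset.univ.sup r, fun i => ?_⟩
  have hi : (↑(box d (r i)) : Set (Site d)) ⊆ ↑(box d (Finset.univ.sup r)) :=
    Finset.coe_subset.2 (box_mono d (Finset.le_sup (f := r) (Finset.mem_univ i)))
  exact (hr i).imp (fun h' => h'.trans hi) (fun h' => h'.trans hi)

/-- The centred box is the translate by `0`: `Λ_L = Λ_L + 0`. [folklore] -/
theorem box_eq_icc_shift_zero (L : ℕ) : box d L = Λ⟦(0 : Site d), L⟧ := by
  ext x
  rw [mem_box, mem_siteIcc_iff]
  simp only [Pi.zero_apply, add_zero]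

/-- The corners of a translated box are ordered. [folklore] -/
theorem icc_shift_le (v : Site d) (L : ℕ) :
    (fun i => -((L : ℕ) : ℤ) + v i) ≤ (fun i => ((L : ℕ) : ℤ) + v i) := by
  intro i
  dsimp only
  omega

/-- Translated boxes grow with `L`. [folklore] -/
theorem icc_shift_mono (v : Site d) {L L' : ℕ} (hLL' : L ≤ L') : Λ⟦v, L⟧ ⊆ Λ⟦v, L'⟧ := by
  intro x hx
  rw [mem_siteIcc_iff] at hx ⊢
  intro i
  have := hx i
  constructor <;> omega

/-- Sandwich, inner side: `Λ_{L - ‖v‖} ⊆ Λ_L + v`. [folklore] -/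
theorem icc_shift_zero_sub_subset (v : Site d) {L : ℕ} (hv : siteRad v ≤ L) :
    Λ⟦(0 : Site d), L - siteRad v⟧ ⊆ Λ⟦v, L⟧ := by
  rw [← box_eq_icc_shift_zero]
  exact box_sub_subset_icc_shift hv

/-- Sandwich, outer side: `Λ_L + v ⊆ Λ_{L + ‖v‖}`. [folklore] -/
theorem icc_shift_subset_zero_add (v : Site d) (L : ℕ) :
    Λ⟦v, L⟧ ⊆ Λ⟦(0 : Site d), L + siteRad v⟧ := by
  rw [← box_eq_icc_shift_zero]
  exact icc_shift_subset_box_add L v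

/-- A coordinate is bounded by the sup-norm. [folklore] -/
theorem natAbs_apply_le_siteRad (v : Site d) (i : Fin d) : (v i).natAbs ≤ siteRad v :=
  Finset.le_sup (f := fun i => (v i).natAbs) (Finset.mem_univ i)

/-- **Admissibility of the probes in large translated boxes**: if `K ⊆ Λ_r` or `ℤ^d ∖ Λ_r ⊆ K`,
then for `L > r + ‖v‖` the probe `K` is inside `Λ_L + v` or meets its inner boundary (at the top
corner). [folklore] -/
theorem probe_adm_icc_shift (hd : 0 < d) {K : Set (Site d)} {r : ℕ}
    (hK : K ⊆ ↑(box d r) ∨ Kᶜ ⊆ ↑(box d r)) (v : Site d) {L : ℕ} (hL : r + siteRad v < L) :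
    (∀ x ∈ K, x ∈ Λ⟦v, L⟧) ∨
      ∃ z : ↥Λ⟦v, L⟧, z.1 ∈ K ∧ z.1 ∈ innerBoundary (zdGraph d) Λ⟦v, L⟧ := by
  rcases hK with hK | hK
  · refine Or.inl fun x hx => ?_
    have h1 : x ∈ box d (L - siteRad v) := box_mono d (by omega) (hK hx)
    rw [box_eq_icc_shift_zero] at h1
    exact icc_shift_zero_sub_subset v (by omega) h1
  · have htop : (fun i => ((L : ℕ) : ℤ) + v i) ∈ Λ⟦v, L⟧ :=
      Finset.mem_Icc.2 ⟨icc_shift_le v L, le_rfl⟩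
    refine Or.inr ⟨⟨_, htop⟩, ?_, mem_innerBoundary_Icc_of_apply_eq_top htop ⟨0, hd⟩ rfl⟩
    by_contra hnot
    have hmem := hK hnot
    rw [Finset.mem_coe, mem_box] at hmem
    have h0 : ((L : ℕ) : ℤ) + v ⟨0, hd⟩ ≤ r := (hmem ⟨0, hd⟩).2
    have h1 := natAbs_apply_le_siteRad v ⟨0, hd⟩
    omega

/-! ### Convergence of the ghost probabilities along translated boxes -/

/-- **The ghost probabilities converge along translated boxes, to a limit independent of the
translation** (Grimmett 2006, proof of Thm. (4.19)(a)–(b): along `Λ_L + v` the sequence is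
non-increasing for `L > r + ‖v‖` by `rcMeasure_real_ghostConnEvent_icc_anti`, hence convergent, and
`Λ_{L-‖v‖} ⊆ Λ_L + v ⊆ Λ_{L+‖v‖}` squeezes it to the limit of the centred sequence): for
`d ≥ 1`, `0 ≤ p ≤ 1`, `q ≥ 1`, probes each finite or co-finite, and every finite set `T` of
index pairs, there is `ℓ` with `φ¹_{Λ_L + v}(ghost event) → ℓ` as `L → ∞`, for every `v ∈ ℤ^d`.
[cite: Grimmett2006, Thm. (4.19), proof] -/
theorem tendsto_rcMeasure_real_ghostConnEvent (hd : 0 < d) {p q : ℝ} (hp : p ∈ Set.Icc (0 : ℝ) 1) (hq : 1 ≤ q)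
    {m : ℕ} {K : Fin m → Set (Site d)} (hK : ∀ i, (K i).Finite ∨ (K i)ᶜ.Finite)
    (T : Finset (Fin m × Fin m)) :
    ∃ ℓ : ℝ, ∀ v : Site d, Tendsto (fun L : ℕ => (μ[p, q](Λ⟦v, L⟧)).real
      {ω | ∀ ij ∈ T, ∃ x y : ↥Λ⟦v, L⟧, x.1 ∈ K ij.1 ∧ y.1 ∈ K ij.2 ∧
        (openGraph ω ⊔ wired (wiredBoundary (zdGraph d) Λ⟦v, L⟧)).Reachable x y}) atTop (𝓝 ℓ) := by
  obtain ⟨r, hr⟩ := exists_probeRadius hK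
  -- the ghost probability of the translated box `Λ_L + v`
  set g : Site d → ℕ → ℝ := fun v L => (μ[p, q](Λ⟦v, L⟧)).real
      {ω | ∀ ij ∈ T, ∃ x y : ↥Λ⟦v, L⟧, x.1 ∈ K ij.1 ∧ y.1 ∈ K ij.2 ∧
        (openGraph ω ⊔ wired (wiredBoundary (zdGraph d) Λ⟦v, L⟧)).Reachable x y}
  -- antitone along inclusion of admissible boxes
  have hanti : ∀ (v w : Site d) (L L' : ℕ), r + siteRad v < L → Λ⟦v, L⟧ ⊆ Λ⟦w, L'⟧ →
      g w L' ≤ g v L := fun v w L L' hL hsub =>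
    rcMeasure_real_ghostConnEvent_icc_anti hd (icc_shift_le v L) hsub hp hq K T
      (fun i => probe_adm_icc_shift hd (hr i) v hL)
  -- the centred tail sequence is antitone and bounded below, hence converges
  have hsr0 : siteRad (0 : Site d) = 0 := by simp [siteRad]
  have htail : Antitone fun n : ℕ => g 0 (n + (r + 1)) := fun n n' hnn' =>
    hanti 0 0 _ _ (by rw [hsr0]; omega) (icc_shift_mono 0 (by omega))
  have hbdd : BddBelow (Set.range fun n : ℕ => g 0 (n + (r + 1))) :=
    ⟨0, by rintro _ ⟨n, rfl⟩; exact measureReal_nonneg⟩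
  have h0 : Tendsto (g 0) atTop (𝓝 (⨅ n : ℕ, g 0 (n + (r + 1)))) :=
    (tendsto_add_atTop_iff_nat (r + 1)).1 (tendsto_atTop_ciInf htail hbdd)
  refine ⟨⨅ n : ℕ, g 0 (n + (r + 1)), fun v => ?_⟩
  have hlo : Tendsto (g 0 ∘ fun L => L + siteRad v) atTop (𝓝 (⨅ n : ℕ, g 0 (n + (r + 1)))) :=
    h0.comp (tendsto_add_atTop_nat (siteRad v))
  have hup : Tendsto (g 0 ∘ fun L => L - siteRad v) atTop (𝓝 (⨅ n : ℕ, g 0 (n + (r + 1)))) :=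
    h0.comp (tendsto_sub_atTop_nat (siteRad v))
  refine tendsto_of_tendsto_of_tendsto_of_le_of_le' hlo hup ?_ ?_
  · filter_upwards [eventually_gt_atTop (r + siteRad v)] with L hL
    exact hanti v 0 L (L + siteRad v) hL (icc_shift_subset_zero_add v L)
  · filter_upwards [eventually_gt_atTop (r + 2 * siteRad v)] with L hL
    exact hanti 0 v (L - siteRad v) L (by rw [hsr0]; omega)
      (icc_shift_zero_sub_subset v (by omega))

end Lattice

end Literature.Probability.LatticeModels

end
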